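import Summits.CriticalPhenomena.PercolationContinuityZ3.Theorems.Transplant.PlanarSkeletonFrmQuasiDefs
import Summits.CriticalPhenomena.PercolationContinuityZ3.Theorems.Transplant.SkelFrmQuasiBParamsSchedA
import Summits.CriticalPhenomena.PercolationContinuityZ3.Theorems.Transplant.SkelFrmBParamsSchedA
import Summits.CriticalPhenomena.PercolationContinuityZ3.Theorems.Transplant.SkelFrmQuasiBParamsExcess
import Summits.CriticalPhenomena.PercolationContinuityZ3.Theorems.Transplant.SkelFrmBParamsExcess
import Summits.CriticalPhenomena.PercolationContinuityZ3.Theorems.Transplant.SkelPhiFatRadius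
import Summits.CriticalPhenomena.PercolationContinuityZ3.Theorems.Transplant.SkelConcRootRadii
import Summits.CriticalPhenomena.PercolationContinuityZ3.Theorems.Transplant.SkelNegBParamsSlotsSU
import Summits.CriticalPhenomena.PercolationContinuityZ3.Theorems.Transplant.SkelFrmQuasi1ParamsLBL
import Summits.CriticalPhenomena.PercolationContinuityZ3.Theorems.Transplant.SkelFrmQuasi1ParamsPO
import Summits.CriticalPhenomena.PercolationContinuityZ3.Theorems.Transplant.SkelFrmQuasiBParamsLF
import Summits.CriticalPhenomena.PercolationContinuityZ3.Theorems.Transplant.SkelFrmQuasiBParamsLFA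
import Summits.CriticalPhenomena.PercolationContinuityZ3.Theorems.Transplant.SkelFrmQuasi1SlotTypes
import HarnessLib
import Summits.CriticalPhenomena.PercolationContinuityZ3.Theorems.Transplant.SkelFrmBParamsSlotsS
/-!
# GEN-Q PORT (WAVE-Q table v0.8 section 2, row G053, U-level L9; captain R-6/R-7 2026-08-27: carrier token swap `PlanarSkeletonFrmFrom ↦ PlanarSkeletonFrmQuasi`)
# of the tree module «Transplant/SkelFrmFromBParamsSlotsS» (sha256 836642926a0c1943…) onto the quasi-step carrier `PlanarSkeletonFrmQuasi` (p507026): «SkelFrmQuasiBParamsSlotsS»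

HAND HUNK (iv) (L-FLOORMAP-1 ④, refuter p5-g28 09:44:57Z «G053 hgapc_US must take Φ.M·cOffS»; design owner p3-g30 09:44:30Z «hgapc : Φ.M·cOffS ≤ gap n stays a top-level floor»):
the fibre block of record sizes its cell radius for the quasi-step column constant — `SUS := ⟨max fcellsA.rmax (cOffS+1), …⟩ ↦ ⟨max fcellsA.rmax (Φ.M·cOffS+1), …⟩`, hence
`SUS_fields/SUS_rmax_ge` (`Φ.M·cOffS + 1 ≤ rmax`), `hgapc_US : Φ.M·cOffS ≤ gap ρ`, `hgapR_US : Φ.M·cOffS + 2L′ + Rex ρ + 2 ≤ gap ρ`, `E₀_SUS` (`69·max rmax (Φ.M·cOffS+1)`); proofs verbatim.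

ORIGINAL TITLE: N2 (frames-only node `SamePDropOfSkeletonFrmFrom₁`, OPEN) params column over `PlanarSkeletonFrm` — (ζ″) ledger, part SlotsS: THE FIBRE-BLOCK SLOT VALUE OF RECORD OVER THE

builds on p205010 (kernel theorem, internal audit signed; external expert review pending) — nothing in this file uses p205010; NOTHING is claimed about any open node
((N3-b), the end state).  Lane `prim-bschramm`, seat `prim-bschramm-stmt` (gen 33; GEN-Q column pen; tool = captain gen-1 g4's port_genq.py R-14 --cone + p3-g30's T1 patch).  Helper file (`--supports stmt-CriticalPhenomena-4575 --as helper`).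
PORT RULES (U-wave r1–r4 re-used, GEN-Q hunk classes of p3-g29 #6136): declaration order, names and proof texts are those of «SkelFrmFromBParamsSlotsS», byte-identical except
(i) the carrier token `PlanarSkeletonFrmFrom ↦ PlanarSkeletonFrmQuasi` in binders, `namespace`/`end` lines and qualified names (module names `SkelFrmFrom… ↦ SkelFrmQuasi…`
in imports of already-ported rows); (ii) `Φ.step ↦ Φ.qstep` with the called Steps lemma replaced by its `…Q`/`_q` twin and the cost `Φ.M` threaded (none in this file unless
listed below); (iii) `Φ.cyl_connected ↦ Φ.cyl_reach` readers (none unless listed); (iv) graph-ball radii / window floors ×`Φ.M` (none unless listed).  Carrier-free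
residents stay imported/exported from the original «SkelFrmBParamsSlotsS» exactly as in the FrmFrom port.  Docstrings and citations are the original's.

-/

noncomputable section

open scoped Classical

namespace Summit.CriticalPhenomena.PercolationContinuityZ3.Theorems.Transplant

namespace PlanarSkeletonFrmQuasi

namespace NegB

open MeasureTheory Literature.Probability.Percolation Literature.Probability.LatticeModels SimpleGraph
open Literature.Barriers.CriticalPhenomena (graphBall)
open SkelConc (Consts)
open BoxProdZ2 (ConcRadiiG Erad Frad nQ)
open Skelφ (oriφ trφ)
open Skelφ.StepI (DataN DataNS)
open Skel (excess)
open Neg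

/-! ## §1 The residual slot type, the seed's fat radius, the φ-diameter of a rim habitat -/

/-- **A (g,f)-level residual slot**: a floor as a function of everything p-fixed AND the box/width values `(g, f)`. [this work] -/
def GSlot : Type 1 :=
  ∀ (κ : Consts) {V : Type} [DecidableEq V] [Countable V] {G : SimpleGraph V} [G.LocallyFinite], PlanarSkeletonFrmQuasi G → V → unitInterval → Skelφ.StepI.DataNS V → ℕ → ℕ → ℕ

-- GEN-Q (R-2, captain 2026-08-27): `PlanarSkeletonFrmFrom.NegB.GSlot.zero` is not in the used cone of the node top — not ported.

/-- **The seed's fat radius `ψπ := fatRadius Φ.frame hC D.k`** as a p-level number (`0` off `Φ.CylSubcritical p`). [cite: KozmaNitzan2024, §4 p. 16 (Lemma 9)] -/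
def ψπ {V : Type} [Countable V] {G : SimpleGraph V} [G.LocallyFinite] (Φ : PlanarSkeletonFrmQuasi G) (p : unitInterval) (D : DataNS V) : ℕ :=
  if h : Φ.CylSubcritical p then Skelφ.fatRadius Φ.frame h D.k else 0

/-- `ψπ = fatRadius Φ.frame hC D.k` under `hC`. [folklore] -/
theorem ψπ_eq {V : Type} [Countable V] {G : SimpleGraph V} [G.LocallyFinite] (Φ : PlanarSkeletonFrmQuasi G) {p : unitInterval} (hC : Φ.CylSubcritical p) (D : DataNS V) :
    ψπ Φ p D = Skelφ.fatRadius Φ.frame hC D.k := by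
  unfold ψπ; rw [dif_pos hC]

section Values

variable (κ : Consts) {V : Type} [DecidableEq V] [Countable V] {G : SimpleGraph V} [G.LocallyFinite] (Φ : PlanarSkeletonFrmQuasi G) (t : V)
  (p : unitInterval) (D : DataNS V) (g f mx : ℕ)

/-- **The φ-diameter of a rim habitat of the (ζ′) cells** (residual slot `mx`): `mRS := max (2·(n_L + ℓ_L + 3|h_L| + 1)·(50·fcellsA.rmax + 1)) mx`. [this work] -/
def mRS (κ : Consts) {V : Type} [DecidableEq V] [Countable V] {G : SimpleGraph V} [G.LocallyFinite] (Φ : PlanarSkeletonFrmQuasi G) (t : V) (p : unitInterval) (D : DataNS V) (g : ℕ) (f : ℕ) (mx : ℕ) : ℕ := max (2 * (nL κ Φ t p D g f + ℓL κ Φ t p D g f + 3 * (hL κ Φ t p D g f).natAbs + 1) * (50 * (fcellsA κ Φ t p D g f).rmax + 1)) mx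

/-- The two floors inside `mRS`. [folklore] -/
theorem mRS_ge (κ : Consts) {V : Type} [DecidableEq V] [Countable V] {G : SimpleGraph V} [G.LocallyFinite] (Φ : PlanarSkeletonFrmQuasi G) (t : V) (p : unitInterval) (D : DataNS V) (g : ℕ) (f : ℕ) (mx : ℕ) : 2 * (nL κ Φ t p D g f + ℓL κ Φ t p D g f + 3 * (hL κ Φ t p D g f).natAbs + 1) * (50 * (fcellsA κ Φ t p D g f).rmax + 1) ≤ mRS κ Φ t p D g f mx ∧
    mx ≤ mRS κ Φ t p D g f mx := ⟨le_max_left _ _, le_max_right _ _⟩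

/-- **FINE DIAMETER ⇒ φ-DIAMETER** for the (ζ′) cells: fine coordinates (map slot `φ′`) within `50·fcellsA.rmax` on both axes give `φ′ d − φ′ d' ∈ box 2 (mRS mx)`. [folklore] -/
theorem fine_diam_le_mRS (κ : Consts) {V : Type} [DecidableEq V] [Countable V] {G : SimpleGraph V} [G.LocallyFinite] (Φ : PlanarSkeletonFrmQuasi G) (t : V) (p : unitInterval) (D : DataNS V) (g : ℕ) (f : ℕ) (mx : ℕ) (hN : EqNumL κ Φ t p D g f) {φ' : V → Site 2} {d d' : V}
    (h : fineA κ Φ t p D g f φ' d - fineA κ Φ t p D g f φ' d' ∈ box 2 (50 * (fcellsA κ Φ t p D g f).rmax)) : φ' d - φ' d' ∈ box 2 (mRS κ Φ t p D g f mx) := by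
  rw [mem_box] at h ⊢
  intro i
  have hρ : ∀ j, |fineA κ Φ t p D g f φ' d j - fineA κ Φ t p D g f φ' d' j| ≤ ((50 * (fcellsA κ Φ t p D g f).rmax : ℕ) : ℤ) := fun j => by
    have hj := h j
    rw [Pi.sub_apply] at hj
    exact abs_le.2 hj
  have hK := (φ_extent_fineA_at κ Φ t p D g f hN (Nat.cast_nonneg _) hρ i).2
  have hm : ((2 * (nL κ Φ t p D g f + ℓL κ Φ t p D g f + 3 * (hL κ Φ t p D g f).natAbs + 1) * (50 * (fcellsA κ Φ t p D g f).rmax + 1) : ℕ) : ℤ) ≤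
      (mRS κ Φ t p D g f mx : ℤ) := by
    exact_mod_cast (mRS_ge κ Φ t p D g f mx).1
  have h2 : 2 * ((nL κ Φ t p D g f : ℤ) + ℓL κ Φ t p D g f + 3 * |hL κ Φ t p D g f| + 1) * (((50 * (fcellsA κ Φ t p D g f).rmax : ℕ) : ℤ) + 1) =
      ((2 * (nL κ Φ t p D g f + ℓL κ Φ t p D g f + 3 * (hL κ Φ t p D g f).natAbs + 1) * (50 * (fcellsA κ Φ t p D g f).rmax + 1) : ℕ) : ℤ) := by
    push_cast; ring
  rw [Pi.sub_apply]
  exact abs_le.1 (hK.trans (h2 ▸ hm))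

end Values

/-! ## §2 The fibre block of record over the staggered cells -/

/-- (GEN-Q hunk (iv) ④: cell radius `Φ.M·cOffS + 1`.) **THE FIBRE BLOCK OF RECORD OF THE (ζ′) CHAIN**: `⟨max fcellsA.rmax (Φ.M·cOffS+1), 1, 0, ψπ, 0, ex κ Φ t p D g f, NegB.Rex (mRS … (mx …)) q⟩`.
[cite: KozmaNitzan2024, §4 Theorem 6 (pp. 25–31): the order of constants] -/
def SUS (ex mx : GSlot) : SSlot := fun κ _ _ _ _ _ Φ t p D g f q =>
  ⟨max (fcellsA κ Φ t p D g f).rmax (Φ.M * cOffS κ Φ t p D g f + 1), 1, 0, ψπ Φ p D, 0, ex κ Φ t p D g f, Rex κ Φ (mRS κ Φ t p D g f (mx κ Φ t p D g f)) q⟩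

section Facts

variable (κ : Consts) {V : Type} [DecidableEq V] [Countable V] {G : SimpleGraph V} [G.LocallyFinite] (Φ : PlanarSkeletonFrmQuasi G) (t : V)
  (p : unitInterval) (D : DataNS V) (g f : ℕ) (ex mx : GSlot) (q : unitInterval)

/-- The fields of `SUS` (all `rfl`). [folklore] -/
theorem SUS_fields (κ : Consts) {V : Type} [DecidableEq V] [Countable V] {G : SimpleGraph V} [G.LocallyFinite] (Φ : PlanarSkeletonFrmQuasi G) (t : V) (p : unitInterval) (D : DataNS V) (g : ℕ) (f : ℕ) (ex : GSlot) (mx : GSlot) (q : unitInterval) : (SUS ex mx κ Φ t p D g f q).rmax = max (fcellsA κ Φ t p D g f).rmax (Φ.M * cOffS κ Φ t p D g f + 1) ∧ (SUS ex mx κ Φ t p D g f q).u = 1 ∧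
    (SUS ex mx κ Φ t p D g f q).M = 0 ∧ (SUS ex mx κ Φ t p D g f q).ψM = ψπ Φ p D ∧ (SUS ex mx κ Φ t p D g f q).ψtop = 0 ∧ (SUS ex mx κ Φ t p D g f q).reachK = ex κ Φ t p D g f ∧
    (SUS ex mx κ Φ t p D g f q).Rex = Rex κ Φ (mRS κ Φ t p D g f (mx κ Φ t p D g f)) q :=
  ⟨rfl, rfl, rfl, rfl, rfl, rfl, rfl⟩

/-- `fcellsA.rmax ≤ rmax` and `Φ.M·cOffS + 1 ≤ rmax`. [folklore] -/
theorem SUS_rmax_ge (κ : Consts) {V : Type} [DecidableEq V] [Countable V] {G : SimpleGraph V} [G.LocallyFinite] (Φ : PlanarSkeletonFrmQuasi G) (t : V) (p : unitInterval) (D : DataNS V) (g : ℕ) (f : ℕ) (ex : GSlot) (mx : GSlot) (q : unitInterval) : (fcellsA κ Φ t p D g f).rmax ≤ (SUS ex mx κ Φ t p D g f q).rmax ∧ Φ.M * cOffS κ Φ t p D g f + 1 ≤ (SUS ex mx κ Φ t p D g f q).rmax :=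
  ⟨le_max_left _ _, le_max_right _ _⟩

/-- **`20·fcellsA.rmax ≤ gap ρ`**. [folklore] -/
theorem hgap20_US (κ : Consts) {V : Type} [DecidableEq V] [Countable V] {G : SimpleGraph V} [G.LocallyFinite] (Φ : PlanarSkeletonFrmQuasi G) (t : V) (p : unitInterval) (D : DataNS V) (g : ℕ) (f : ℕ) (ex : GSlot) (mx : GSlot) (q : unitInterval) (ρ : ℕ) : 20 * (fcellsA κ Φ t p D g f).rmax ≤ Skelφ.Prm.gap (SUS ex mx κ Φ t p D g f q) ρ :=
  le_trans (Nat.mul_le_mul_left _ (SUS_rmax_ge κ Φ t p D g f ex mx q).1) (Skelφ.Prm.twenty_rmax_le_gap _ ρ)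

/-- **`Φ.M·cOffS ≤ gap ρ`** (the quasi `hgapc` floor at `c := Φ.M·cOffS`). [folklore] -/
theorem hgapc_US (κ : Consts) {V : Type} [DecidableEq V] [Countable V] {G : SimpleGraph V} [G.LocallyFinite] (Φ : PlanarSkeletonFrmQuasi G) (t : V) (p : unitInterval) (D : DataNS V) (g : ℕ) (f : ℕ) (ex : GSlot) (mx : GSlot) (q : unitInterval) (ρ : ℕ) : Φ.M * cOffS κ Φ t p D g f ≤ Skelφ.Prm.gap (SUS ex mx κ Φ t p D g f q) ρ := by
  have h1 := (SUS_rmax_ge κ Φ t p D g f ex mx q).2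
  have h2 := Skelφ.Prm.dG_le_gap (SUS ex mx κ Φ t p D g f q) ρ
  exact le_trans (le_trans (le_trans (Nat.le_succ _) h1) (Nat.le_mul_of_pos_left _ (by norm_num))) h2

/-- **`Φ.M·cOffS + 2L′ + Rex ρ + 2 ≤ gap ρ`** (the quasi `hgapR` floor). [folklore] -/
theorem hgapR_US (κ : Consts) {V : Type} [DecidableEq V] [Countable V] {G : SimpleGraph V} [G.LocallyFinite] (Φ : PlanarSkeletonFrmQuasi G) (t : V) (p : unitInterval) (D : DataNS V) (g : ℕ) (f : ℕ) (ex : GSlot) (mx : GSlot) (q : unitInterval) (ρ : ℕ) : Φ.M * cOffS κ Φ t p D g f + 2 * Skelφ.Prm.Lp (SUS ex mx κ Φ t p D g f q) + Rex κ Φ (mRS κ Φ t p D g f (mx κ Φ t p D g f)) q ρ + 2 ≤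
    Skelφ.Prm.gap (SUS ex mx κ Φ t p D g f q) ρ := by
  rw [Skelφ.Prm.gap_eq]
  have h1 : Φ.M * cOffS κ Φ t p D g f + 1 ≤ (SUS ex mx κ Φ t p D g f q).rmax := (SUS_rmax_ge κ Φ t p D g f ex mx q).2
  have h2 : Rex κ Φ (mRS κ Φ t p D g f (mx κ Φ t p D g f)) q ρ ≤ (SUS ex mx κ Φ t p D g f q).Rex (ρ + 1) := Rex_mono κ Φ _ q (Nat.le_succ ρ)
  generalize (SUS ex mx κ Φ t p D g f q).rmax = R at h1 ⊢
  generalize (SUS ex mx κ Φ t p D g f q).Rex (ρ + 1) = X at h2 ⊢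
  generalize Skelφ.Prm.Lp (SUS ex mx κ Φ t p D g f q) = L
  omega

/-- `L′ ≤ gap ρ`. [folklore] -/
theorem hgapL_US (κ : Consts) {V : Type} [DecidableEq V] [Countable V] {G : SimpleGraph V} [G.LocallyFinite] (Φ : PlanarSkeletonFrmQuasi G) (t : V) (p : unitInterval) (D : DataNS V) (g : ℕ) (f : ℕ) (ex : GSlot) (mx : GSlot) (q : unitInterval) (ρ : ℕ) : Skelφ.Prm.Lp (SUS ex mx κ Φ t p D g f q) ≤ Skelφ.Prm.gap (SUS ex mx κ Φ t p D g f q) ρ := Skelφ.Prm.hgapL _ ρ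

/-- **`ex ≤ L′ ≤ E₀`**. [folklore] -/
theorem ex_le_Lp_US (κ : Consts) {V : Type} [DecidableEq V] [Countable V] {G : SimpleGraph V} [G.LocallyFinite] (Φ : PlanarSkeletonFrmQuasi G) (t : V) (p : unitInterval) (D : DataNS V) (g : ℕ) (f : ℕ) (ex : GSlot) (mx : GSlot) (q : unitInterval) : ex κ Φ t p D g f ≤ Skelφ.Prm.Lp (SUS ex mx κ Φ t p D g f q) ∧ Skelφ.Prm.Lp (SUS ex mx κ Φ t p D g f q) ≤ Skelφ.Prm.E₀ (SUS ex mx κ Φ t p D g f q) := by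
  refine ⟨?_, Skelφ.Prm.Lp_le_E₀ _⟩
  have h := Skelφ.Prm.reachK_le_Lp (SUS ex mx κ Φ t p D g f q)
  exact h

/-- `3 ≤ E₀`, indeed `45·fcellsA.rmax ≤ E₀`. [folklore] -/
theorem three_le_E₀_US (κ : Consts) {V : Type} [DecidableEq V] [Countable V] {G : SimpleGraph V} [G.LocallyFinite] (Φ : PlanarSkeletonFrmQuasi G) (t : V) (p : unitInterval) (D : DataNS V) (g : ℕ) (f : ℕ) (ex : GSlot) (mx : GSlot) (q : unitInterval) : 3 ≤ Skelφ.Prm.E₀ (SUS ex mx κ Φ t p D g f q) ∧ 45 * (fcellsA κ Φ t p D g f).rmax ≤ Skelφ.Prm.E₀ (SUS ex mx κ Φ t p D g f q) := by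
  have h1 := Skelφ.Prm.planar_le_E₀ (SUS ex mx κ Φ t p D g f q)
  have h2 := (SUS_rmax_ge κ Φ t p D g f ex mx q).1
  have h3 : 1 ≤ (fcellsA κ Φ t p D g f).rmax := le_trans ((fcellsA κ Φ t p D g f).one_le_r 0) ((fcellsA κ Φ t p D g f).r_le_rmax 0)
  have h4 : 45 * (fcellsA κ Φ t p D g f).rmax ≤ Skelφ.Prm.E₀ (SUS ex mx κ Φ t p D g f q) :=
    le_trans (le_trans (Nat.mul_le_mul_left 45 h2) (Nat.le_add_right _ _)) h1
  exact ⟨le_trans (le_trans (by norm_num : 3 ≤ 45 * 1) (Nat.mul_le_mul_left 45 h3)) h4, h4⟩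

-- GEN-Q (R-2, captain 2026-08-27): `PlanarSkeletonFrmFrom.NegB.hsch_US` is not in the used cone of the node top — not ported.

-- GEN-Q (R-2, captain 2026-08-27): `PlanarSkeletonFrmFrom.NegB.Rex_mono_US` is not in the used cone of the node top — not ported.

/-- **`hR₁` at the value** (depth `ρ+1`, any centre, either orientation, any `η' ≥ η`, planar diameter `mRS`), consumer's instance. [folklore] -/
theorem hR₁_US (κ : Consts) {V : Type} [DecidableEq V] [Countable V] {G : SimpleGraph V} [G.LocallyFinite] (Φ : PlanarSkeletonFrmQuasi G) (t : V) (p : unitInterval) (D : DataNS V) (g : ℕ) (f : ℕ) (ex : GSlot) (mx : GSlot) (q : unitInterval) (hC : Φ.CylSubcritical q) (o : Bool) {η' : ℝ} (hη' : Neg.η κ Φ ≤ η') (c : V) :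
    ∀ ρ R', (SUS ex mx κ Φ t p D g f q).Rex ρ ≤ R' → ∀ (Rw : ℕ) (D' A' : Finset V), (∀ d ∈ D', d ∈ graphBall G c Rw) →
      (∀ d ∈ D', ∀ d' ∈ D', oriφ Φ.φ o d - oriφ Φ.φ o d' ∈ box 2 (mRS κ Φ t p D g f (mx κ Φ t p D g f))) → A' ⊆ D' → (∀ a ∈ A', a ∈ graphBall G c (ρ + 1)) →
        (bondPercolation G q).real (excess G c R' D' A') ≤ η' := by
  have hη'' : @Neg.η κ V (fun a b => Classical.propDecidable (a = b)) _ G _ Φ ≤ η' := by convert hη' using 2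
  exact hR₁_at κ Φ (mRS κ Φ t p D g f (mx κ Φ t p D g f)) hC o hη'' c

/-- **`hRex` at the value** (depth `R₀'`), consumer's instance. [folklore] -/
theorem hRex_US (κ : Consts) {V : Type} [DecidableEq V] [Countable V] {G : SimpleGraph V} [G.LocallyFinite] (Φ : PlanarSkeletonFrmQuasi G) (t : V) (p : unitInterval) (D : DataNS V) (g : ℕ) (f : ℕ) (ex : GSlot) (mx : GSlot) (q : unitInterval) (hC : Φ.CylSubcritical q) (o : Bool) {η' : ℝ} (hη' : Neg.η κ Φ ≤ η') (c : V) :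
    ∀ R₀' R₁, (SUS ex mx κ Φ t p D g f q).Rex R₀' ≤ R₁ → ∀ (Rw : ℕ) (D' A' : Finset V), (∀ d ∈ D', d ∈ graphBall G c Rw) →
      (∀ d ∈ D', ∀ d' ∈ D', oriφ Φ.φ o d - oriφ Φ.φ o d' ∈ box 2 (mRS κ Φ t p D g f (mx κ Φ t p D g f))) → A' ⊆ D' → (∀ a ∈ A', a ∈ graphBall G c R₀') →
        (bondPercolation G q).real (excess G c R₁ D' A') ≤ η' := by
  have hη'' : @Neg.η κ V (fun a b => Classical.propDecidable (a = b)) _ G _ Φ ≤ η' := by convert hη' using 2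
  exact hRex_at κ Φ (mRS κ Φ t p D g f (mx κ Φ t p D g f)) hC o hη'' c

/-- `hR₁` at the value with `η' := η`. [folklore] -/
theorem hR₁_US_η (κ : Consts) {V : Type} [DecidableEq V] [Countable V] {G : SimpleGraph V} [G.LocallyFinite] (Φ : PlanarSkeletonFrmQuasi G) (t : V) (p : unitInterval) (D : DataNS V) (g : ℕ) (f : ℕ) (ex : GSlot) (mx : GSlot) (q : unitInterval) (hC : Φ.CylSubcritical q) (o : Bool) (c : V) :
    ∀ ρ R', (SUS ex mx κ Φ t p D g f q).Rex ρ ≤ R' → ∀ (Rw : ℕ) (D' A' : Finset V), (∀ d ∈ D', d ∈ graphBall G c Rw) →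
      (∀ d ∈ D', ∀ d' ∈ D', oriφ Φ.φ o d - oriφ Φ.φ o d' ∈ box 2 (mRS κ Φ t p D g f (mx κ Φ t p D g f))) → A' ⊆ D' → (∀ a ∈ A', a ∈ graphBall G c (ρ + 1)) →
        (bondPercolation G q).real (excess G c R' D' A') ≤ Neg.η κ Φ :=
  hR₁_US κ Φ t p D g f ex mx q hC o le_rfl c

/-- **`E₀ (SUS …) = ex + Rex κ Φ mRS q (2·ψπ) + 69·rmax′ + 4·ψπ + 48`** (`rmax′ := max fcellsA.rmax (Φ.M·cOffS+1)`). [folklore] -/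
theorem E₀_SUS_eq (κ : Consts) {V : Type} [DecidableEq V] [Countable V] {G : SimpleGraph V} [G.LocallyFinite] (Φ : PlanarSkeletonFrmQuasi G) (t : V) (p : unitInterval) (D : DataNS V) (g : ℕ) (f : ℕ) (ex : GSlot) (mx : GSlot) (q : unitInterval) : Skelφ.Prm.E₀ (SUS ex mx κ Φ t p D g f q) =
    ex κ Φ t p D g f + Rex κ Φ (mRS κ Φ t p D g f (mx κ Φ t p D g f)) q (2 * ψπ Φ p D) + 69 * max (fcellsA κ Φ t p D g f).rmax (Φ.M * cOffS κ Φ t p D g f + 1) + 4 * ψπ Φ p D + 48 := by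
  show Skelφ.Prm.Lp _ + 45 * max (fcellsA κ Φ t p D g f).rmax (Φ.M * cOffS κ Φ t p D g f + 1) + ψπ Φ p D = _
  unfold Skelφ.Prm.Lp Skelφ.Prm.LA Skelφ.Prm.dL
  show 24 * max (fcellsA κ Φ t p D g f).rmax (Φ.M * cOffS κ Φ t p D g f + 1) + 2 * (0 + ψπ Φ p D) + Rex κ Φ (mRS κ Φ t p D g f (mx κ Φ t p D g f)) q (2 * ψπ Φ p D) +
      (24 * 1 + 8 * 0 + 12) + 0 + ψπ Φ p D + 12 * 1 + 2 * 0 + ex κ Φ t p D g f + 45 * max (fcellsA κ Φ t p D g f).rmax (Φ.M * cOffS κ Φ t p D g f + 1) + ψπ Φ p D = _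
  ring

/-- `L′ (SUS …) = ex + Rex(2ψπ) + 24·rmax′ + 3·ψπ + 48`. [folklore] -/
theorem Lp_SUS_eq (κ : Consts) {V : Type} [DecidableEq V] [Countable V] {G : SimpleGraph V} [G.LocallyFinite] (Φ : PlanarSkeletonFrmQuasi G) (t : V) (p : unitInterval) (D : DataNS V) (g : ℕ) (f : ℕ) (ex : GSlot) (mx : GSlot) (q : unitInterval) : Skelφ.Prm.Lp (SUS ex mx κ Φ t p D g f q) =
    ex κ Φ t p D g f + Rex κ Φ (mRS κ Φ t p D g f (mx κ Φ t p D g f)) q (2 * ψπ Φ p D) + 24 * max (fcellsA κ Φ t p D g f).rmax (Φ.M * cOffS κ Φ t p D g f + 1) + 3 * ψπ Φ p D + 48 := by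
  unfold Skelφ.Prm.Lp Skelφ.Prm.LA Skelφ.Prm.dL
  show 24 * max (fcellsA κ Φ t p D g f).rmax (Φ.M * cOffS κ Φ t p D g f + 1) + 2 * (0 + ψπ Φ p D) + Rex κ Φ (mRS κ Φ t p D g f (mx κ Φ t p D g f)) q (2 * ψπ Φ p D) +
      (24 * 1 + 8 * 0 + 12) + 0 + ψπ Φ p D + 12 * 1 + 2 * 0 + ex κ Φ t p D g f = _
  ring

end Facts

/-! ## §3 The root radius `Rπ := E₀ − 1` (any block) and the four root radii at the schedule of record -/

section RootRadii

variable (κ : Consts) {V : Type} [DecidableEq V] [Countable V] {G : SimpleGraph V} [G.LocallyFinite] (Φ : PlanarSkeletonFrmQuasi G) (t : V)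
  (p : unitInterval) (D : DataNS V) (g f : ℕ) (c : Fin 2 → ℕ) (Sv : SSlot) (q : unitInterval)

/-- **THE ROOT RADIUS OF RECORD** `Rπ := E₀ (Sv … q) − 1` (p3-g9's slot `Rπ` of `rootOblTWAt_negBS_x/_y`; bound under `AtQO O q`, so it may read `q`). [this work] -/
def Rπ (κ : Consts) {V : Type} [DecidableEq V] [Countable V] {G : SimpleGraph V} [G.LocallyFinite] (Φ : PlanarSkeletonFrmQuasi G) (t : V) (p : unitInterval) (D : DataNS V) (g : ℕ) (f : ℕ) (Sv : SSlot) (q : unitInterval) : ℕ := Skelφ.Prm.E₀ (Sv κ Φ t p D g f q) - 1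

/-- `Rπ + 1 = E₀`. [folklore] -/
theorem Rπ_succ (κ : Consts) {V : Type} [DecidableEq V] [Countable V] {G : SimpleGraph V} [G.LocallyFinite] (Φ : PlanarSkeletonFrmQuasi G) (t : V) (p : unitInterval) (D : DataNS V) (g : ℕ) (f : ℕ) (Sv : SSlot) (q : unitInterval) : Rπ κ Φ t p D g f Sv q + 1 = Skelφ.Prm.E₀ (Sv κ Φ t p D g f q) := by
  have := PlanarSkeletonNeg.NegB.twelve_le_E₀ (Sv κ Φ t p D g f q); unfold Rπ; omega

-- GEN-Q (R-2, captain 2026-08-27): `PlanarSkeletonFrmFrom.NegB.hRQ_RS` is not in the used cone of the node top — not ported.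

-- GEN-Q (R-2, captain 2026-08-27): `PlanarSkeletonFrmFrom.NegB.hRB_RS` is not in the used cone of the node top — not ported.

-- GEN-Q (R-2, captain 2026-08-27): `PlanarSkeletonFrmFrom.NegB.hRQ'_RS` is not in the used cone of the node top — not ported.

-- GEN-Q (R-2, captain 2026-08-27): `PlanarSkeletonFrmFrom.NegB.hRM_RS` is not in the used cone of the node top — not ported.

/-- `X + 1 ≤ E₀ → X ≤ Rπ`. [folklore] -/
theorem le_Rπ_of (κ : Consts) {V : Type} [DecidableEq V] [Countable V] {G : SimpleGraph V} [G.LocallyFinite] (Φ : PlanarSkeletonFrmQuasi G) (t : V) (p : unitInterval) (D : DataNS V) (g : ℕ) (f : ℕ) (Sv : SSlot) (q : unitInterval) {X : ℕ} (h : X + 1 ≤ Skelφ.Prm.E₀ (Sv κ Φ t p D g f q)) : X ≤ Rπ κ Φ t p D g f Sv q := by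
  unfold Rπ; omega

/-- `X + 1 ≤ reachK → X ≤ Rπ` (`reachK ≤ L′ ≤ E₀`). [folklore] -/
theorem le_Rπ_of_reachK (κ : Consts) {V : Type} [DecidableEq V] [Countable V] {G : SimpleGraph V} [G.LocallyFinite] (Φ : PlanarSkeletonFrmQuasi G) (t : V) (p : unitInterval) (D : DataNS V) (g : ℕ) (f : ℕ) (Sv : SSlot) (q : unitInterval) {X : ℕ} (h : X + 1 ≤ (Sv κ Φ t p D g f q).reachK) : X ≤ Rπ κ Φ t p D g f Sv q :=
  le_Rπ_of κ Φ t p D g f Sv q (le_trans h (le_trans (Skelφ.Prm.reachK_le_Lp _) (Skelφ.Prm.Lp_le_E₀ _)))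

end RootRadii

/-! ## §4 The `Rπ`-inequalities of the root residue at `SUS`, as floors on `ex` -/

section RootSU

variable (κ : Consts) {V : Type} [DecidableEq V] [Countable V] {G : SimpleGraph V} [G.LocallyFinite] (Φ : PlanarSkeletonFrmQuasi G) (t : V)
  (p : unitInterval) (D : DataNS V) (g f : ℕ) (ex mx : GSlot) (q : unitInterval)

/-- **`X + 1 ≤ ex → X ≤ Rπ`** (p3's `hRlπ hπ1 hπ2 hRb₀ hRr₀ hRbπ`: each a floor on `ex`). [folklore] -/
theorem ex_le_Rπ (κ : Consts) {V : Type} [DecidableEq V] [Countable V] {G : SimpleGraph V} [G.LocallyFinite] (Φ : PlanarSkeletonFrmQuasi G) (t : V) (p : unitInterval) (D : DataNS V) (g : ℕ) (f : ℕ) (ex : GSlot) (mx : GSlot) (q : unitInterval) {X : ℕ} (h : X + 1 ≤ ex κ Φ t p D g f) : X ≤ Rπ κ Φ t p D g f (SUS ex mx) q :=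
  le_Rπ_of_reachK κ Φ t p D g f (SUS ex mx) q h

-- GEN-Q (R-2, captain 2026-08-27): `PlanarSkeletonFrmFrom.NegB.fat_le_Rπ` is not in the used cone of the node top — not ported.

-- GEN-Q (R-2, captain 2026-08-27): `PlanarSkeletonFrmFrom.NegB.Rex_fat_le_Rπ_sub` is not in the used cone of the node top — not ported.

-- GEN-Q (R-2, captain 2026-08-27): `PlanarSkeletonFrmFrom.NegB.SRex_fat_le_Rπ_sub` is not in the used cone of the node top — not ported.

end RootSU

end NegB

end PlanarSkeletonFrmQuasi

end Summit.CriticalPhenomena.PercolationContinuityZ3.Theorems.Transplant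

end
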